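import Mathlib
import Summits.MatrixMultiplication.MatrixMultiplication.Theses.LevelGradedCohnUmans
import Literature.RepresentationTheory.FiniteGroups.CharacterDegrees
import Literature.Barriers.MatrixMultiplication.NormalizerBarrier

/-!
# Sketch — crux LieRankDesigns (stmt-MatrixMultiplication-7614), crux-ideate round 1, ideator k = 2

First lemmas of the two idea cards `fixed-rank-universality-gl2-level-one` and
`borel-configuration-identity-test`, stated over the crux's own binders (the Fourier-rank-≤k test
space is INLINED in the crux; here it is named `IsRankTest` / `RankSeparated` / `gradedBudget`, each
definitionally the crux's inline expression).  PROVED here (standard axioms only):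
`LieRankDesigns_of_levelOneGL2` (universality of the (2,1) instance: level-one GL_2 designs + the
elementary budget bound ⇒ the crux BY NAME), `isRankTest_translate` (bi-invariance of F_k),
`subgroup_rankSeparated_iff` (subgroup designs ⇔ subgroup TPP + ONE identity test),
`borelConfig_subgroupTPP` (Borel configurations have the TPP).  Still `sorry` (statements only, as
allowed at crux-ideate): `isRankTest_iff_frameTest` (k-frame-token form of F_k) and
`levelOne_budget_GL2` (Mackey decomposition of ℂ[𝔽_p²]).
-/

noncomputable section

open scoped BigOperators
open Literature.RepresentationTheory.FiniteGroups

namespace Summit.MatrixMultiplication.MatrixMultiplication.Cruxes.LieRankDesigns.Ideator2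

/-- `GL_m(𝔽_p)` as in the crux. -/
abbrev GLp (m p : ℕ) := Matrix.GeneralLinearGroup (Fin m) (ZMod p)

/-- The crux's test space `F_k`: `f(g) = Σ_{rk M ≤ k} c_M ψ(tr(M g))`, `ψ = ZMod.stdAddChar`
(literally the set-builder predicate inlined twice in `LieRankDesigns`). -/
def IsRankTest (p m k : ℕ) [Fact p.Prime] (f : GLp m p → ℂ) : Prop :=
  ∃ c : Matrix (Fin m) (Fin m) (ZMod p) → ℂ, (∀ M, k < M.rank → c M = 0) ∧
    ∀ g : GLp m p, f g = ∑ M : Matrix (Fin m) (Fin m) (ZMod p),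
      c M * ZMod.stdAddChar (Matrix.trace (M * (g : Matrix (Fin m) (Fin m) (ZMod p))))

/-- The crux's separation clause for a triple `X, Y, Z ⊆ GL_m(𝔽_p)` at Fourier rank `≤ k`. -/
def RankSeparated (p m k : ℕ) [Fact p.Prime] (X Y Z : Finset (GLp m p)) : Prop :=
  ∀ x₀ ∈ X, ∀ z₀ ∈ Z, ∃ c : Matrix (Fin m) (Fin m) (ZMod p) → ℂ, (∀ M, k < M.rank → c M = 0) ∧
    ∀ x ∈ X, ∀ y ∈ Y, ∀ y' ∈ Y, ∀ z ∈ Z,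
      (∑ M : Matrix (Fin m) (Fin m) (ZMod p), c M * ZMod.stdAddChar (Matrix.trace
        (M * ((x⁻¹ * y * y'⁻¹ * z : GLp m p) : Matrix (Fin m) (Fin m) (ZMod p))))) =
        if x = x₀ ∧ y = y' ∧ z = z₀ then 1 else 0

/-- The crux's graded budget `Σ_{χ ∈ Irr(GL_m(𝔽_p)) ∩ F_k} χ(1)^s`. -/
def gradedBudget (p m k : ℕ) [Fact p.Prime] (s : ℝ) : ℝ :=
  ∑ᶠ χ ∈ irrChars (GLp m p) ∩ {f | IsRankTest p m k f}, (χ 1).re ^ s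

/-! ## Card `fixed-rank-universality-gl2-level-one` -/

/-- FIRST LEMMA (a) — the permutation-module form of the test space ("k-frame tokens"):
`F_k = span{g ↦ 1[gU = C] : U, C ∈ M_{m×k}(𝔽_p)}`, i.e. `f ∈ F_k` iff `f(g) = Σ_U c(U, gU)`.
(`ψ(tr(Vᵀ g U)) = Σ_C ψ(tr(Vᵀ C))·1[gU = C]` and `1[gU = C] = p^{-mk} Σ_V ψ(-tr(VᵀC)) ψ(tr((U Vᵀ) g))`,
`rk(U Vᵀ) ≤ k`.)  This identifies `Irr ∩ F_k` with the constituents of `ℂ[M_{m×k}(𝔽_p)]`. -/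
theorem isRankTest_iff_frameTest (p m k : ℕ) [Fact p.Prime] (f : GLp m p → ℂ) :
    IsRankTest p m k f ↔
      ∃ c : Matrix (Fin m) (Fin k) (ZMod p) → Matrix (Fin m) (Fin k) (ZMod p) → ℂ,
        ∀ g : GLp m p, f g = ∑ U : Matrix (Fin m) (Fin k) (ZMod p),
          c U ((g : Matrix (Fin m) (Fin m) (ZMod p)) * U) := by
  sorry

/-- FIRST LEMMA (b) — the level-one budget of `GL_2(𝔽_p)` (TokenBudget analogue):
`Irr(GL_2(𝔽_p)) ∩ F_1 = {1, St, π(θ,1) : θ ≠ 1}` (constituents of `ℂ[𝔽_p²] = ℂ[0] ⊕ Ind_{Stab e₁}^G 1`),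
so `Σ χ(1)^s ≤ 1 + p^s + (p-2)(p+1)^s` for every real `s ≥ 0` (equality for odd `p`). -/
theorem levelOne_budget_GL2 (p : ℕ) [Fact p.Prime] (hp : 2 < p) (s : ℝ) (hs : 0 ≤ s) :
    gradedBudget p 2 1 s ≤ 1 + (p : ℝ) ^ s + ((p : ℝ) - 2) * ((p : ℝ) + 1) ^ s := by
  sorry

/-- The level-one design conjecture for `GL_2(𝔽_p)` (Transfer `C⁺` of the card): wall-saturating
rank-1-separated triples up to a constant, along an unbounded set of primes. -/
def LevelOneGL2Designs : Prop :=
  ∃ c : ℝ, 0 < c ∧ ∀ p₀ : ℕ, ∃ (p : ℕ) (_ : Fact p.Prime), p₀ ≤ p ∧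
    ∃ X Y Z : Finset (GLp 2 p), RankSeparated p 2 1 X Y Z ∧
      c * (p : ℝ) ^ (3 / 2 : ℝ) ≤ X.card ∧ c * (p : ℝ) ^ (3 / 2 : ℝ) ≤ Y.card ∧
      c * (p : ℝ) ^ (3 / 2 : ℝ) ≤ Z.card

/-- FIRST LEMMA (c) — UNIVERSALITY OF THE SMALLEST INSTANCE: level-one designs in `GL_2(𝔽_p)` of size
`≥ c p^{3/2}` (any fixed `c > 0`, `p → ∞`) already give the crux for EVERY `ε`, because the budget
`1 + p^{2+ε} + (p-2)(p+1)^{2+ε} ≤ 8 p^{3+ε}` loses to `V^{(2+ε)/3} ≥ c^{2+ε} p^{3 + 3ε/2}` once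
`p^{ε/2} > 8 / c^{2+ε}`.  Pure real-exponent bookkeeping over the two facts. -/
theorem LieRankDesigns_of_levelOneGL2
    (hbudget : ∀ (p : ℕ) [Fact p.Prime], 2 < p → ∀ s : ℝ, 0 ≤ s →
      gradedBudget p 2 1 s ≤ 1 + (p : ℝ) ^ s + ((p : ℝ) - 2) * ((p : ℝ) + 1) ^ s)
    (hdesign : LevelOneGL2Designs) :
    Summit.MatrixMultiplication.MatrixMultiplication.Theses.LevelGradedCohnUmans.LieRankDesigns := by
  intro ε hε
  obtain ⟨c, hc, hall⟩ := hdesign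
  set s : ℝ := 2 + ε with hs_def
  have hs : 0 < s := by rw [hs_def]; linarith
  set K : ℝ := (2 / c) ^ s with hK_def
  have hK : 0 ≤ K := by rw [hK_def]; positivity
  obtain ⟨N, hN⟩ := exists_nat_gt (max 3 (K ^ (2 / ε)))
  obtain ⟨p, hprime, hNp, X, Y, Z, hsep, hX, hY, hZ⟩ := hall N
  have hNR : (N : ℝ) ≤ p := by exact_mod_cast hNp
  have hp3 : (3 : ℝ) < p := lt_of_lt_of_le (lt_of_le_of_lt (le_max_left _ _) hN) hNR
  have hpK : K ^ (2 / ε) < p := lt_of_lt_of_le (lt_of_le_of_lt (le_max_right _ _) hN) hNR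
  have hp2 : 2 < p := by exact_mod_cast (show (2 : ℝ) < p by linarith)
  have hp0 : (0 : ℝ) < p := by linarith
  have hp1 : (1 : ℝ) ≤ p := by linarith
  -- the key threshold: K < p ^ (ε/2)
  have hKp : K < (p : ℝ) ^ (ε / 2) := by
    have h1 : (K ^ (2 / ε)) ^ (ε / 2) < (p : ℝ) ^ (ε / 2) :=
      Real.rpow_lt_rpow (by positivity) hpK (by positivity)
    have h2 : (K ^ (2 / ε)) ^ (ε / 2) = K := by
      rw [← Real.rpow_mul hK]
      have : (2 / ε) * (ε / 2) = 1 := by field_simp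
      rw [this, Real.rpow_one]
    rwa [h2] at h1
  refine ⟨p, hprime, 2, 1, X, Y, Z, hsep, ?_⟩
  have hb := hbudget p hp2 s hs.le
  change gradedBudget p 2 1 s < ((X.card * Y.card * Z.card : ℕ) : ℝ) ^ (s / 3)
  -- upper bound for the budget: ≤ 2^s * p^(1+s)
  have hps : (p : ℝ) ^ s ≤ ((p : ℝ) + 1) ^ s :=
    Real.rpow_le_rpow hp0.le (by linarith) hs.le
  have h1s : (1 : ℝ) ≤ ((p : ℝ) + 1) ^ s := Real.one_le_rpow (by linarith) hs.le
  have hq0 : (0 : ℝ) ≤ ((p : ℝ) + 1) ^ s := by positivity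
  have hbud1 : 1 + (p : ℝ) ^ s + ((p : ℝ) - 2) * ((p : ℝ) + 1) ^ s ≤ (p : ℝ) * ((p : ℝ) + 1) ^ s := by
    nlinarith
  have hbud2 : (p : ℝ) * ((p : ℝ) + 1) ^ s ≤ (2 : ℝ) ^ s * (p : ℝ) ^ (1 + s) := by
    have h : ((p : ℝ) + 1) ^ s ≤ (2 * (p : ℝ)) ^ s :=
      Real.rpow_le_rpow (by linarith) (by linarith) hs.le
    rw [Real.mul_rpow (by norm_num) hp0.le] at h
    rw [Real.rpow_add hp0, Real.rpow_one]
    nlinarith [Real.rpow_nonneg hp0.le s]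
  -- lower bound for the volume side
  have hc32 : 0 < c * (p : ℝ) ^ (3 / 2 : ℝ) := by positivity
  have hXpos : (0 : ℝ) < X.card := lt_of_lt_of_le hc32 hX
  have hYpos : (0 : ℝ) < Y.card := lt_of_lt_of_le hc32 hY
  have hZpos : (0 : ℝ) < Z.card := lt_of_lt_of_le hc32 hZ
  have hV : (c * (p : ℝ) ^ (3 / 2 : ℝ)) ^ (3 : ℕ) ≤ ((X.card * Y.card * Z.card : ℕ) : ℝ) := by
    push_cast
    have := mul_le_mul (mul_le_mul hX hY hc32.le hXpos.le) hZ hc32.le (by positivity)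
    nlinarith [this]
  have hV' : ((c * (p : ℝ) ^ (3 / 2 : ℝ)) ^ (3 : ℕ)) ^ (s / 3) ≤ ((X.card * Y.card * Z.card : ℕ) : ℝ) ^ (s / 3) :=
    Real.rpow_le_rpow (by positivity) hV (by positivity)
  have hV'' : ((c * (p : ℝ) ^ (3 / 2 : ℝ)) ^ (3 : ℕ)) ^ (s / 3) = c ^ s * ((p : ℝ) ^ (1 + s) * (p : ℝ) ^ (ε / 2)) := by
    rw [← Real.rpow_natCast, ← Real.rpow_mul hc32.le]
    have h3 : ((3 : ℕ) : ℝ) * (s / 3) = s := by push_cast; ring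
    rw [h3, Real.mul_rpow hc.le (by positivity), ← Real.rpow_mul hp0.le, ← Real.rpow_add hp0]
    congr 1
    congr 1
    rw [hs_def]; ring
  -- combine
  have hfinal : (2 : ℝ) ^ s * (p : ℝ) ^ (1 + s) < c ^ s * ((p : ℝ) ^ (1 + s) * (p : ℝ) ^ (ε / 2)) := by
    have hcs : 0 < c ^ s := Real.rpow_pos_of_pos hc s
    have hp1s : 0 < (p : ℝ) ^ (1 + s) := Real.rpow_pos_of_pos hp0 _
    have hKc : c ^ s * K = (2 : ℝ) ^ s := by
      rw [hK_def, Real.div_rpow (by norm_num) hc.le]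
      field_simp
    calc (2 : ℝ) ^ s * (p : ℝ) ^ (1 + s) = c ^ s * ((p : ℝ) ^ (1 + s) * K) := by rw [← hKc]; ring
      _ < c ^ s * ((p : ℝ) ^ (1 + s) * (p : ℝ) ^ (ε / 2)) := by
        gcongr
  calc gradedBudget p 2 1 s ≤ 1 + (p : ℝ) ^ s + ((p : ℝ) - 2) * ((p : ℝ) + 1) ^ s := hb
    _ ≤ (p : ℝ) * ((p : ℝ) + 1) ^ s := hbud1
    _ ≤ (2 : ℝ) ^ s * (p : ℝ) ^ (1 + s) := hbud2
    _ < c ^ s * ((p : ℝ) ^ (1 + s) * (p : ℝ) ^ (ε / 2)) := hfinal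
    _ = ((c * (p : ℝ) ^ (3 / 2 : ℝ)) ^ (3 : ℕ)) ^ (s / 3) := hV''.symm
    _ ≤ ((X.card * Y.card * Z.card : ℕ) : ℝ) ^ (s / 3) := hV'

/-- The cube milestone at level one (KillLinkLevelTwo analogue, `ω < 3` under the radar from
`GL_2(𝔽_p)`): ONE prime `p` and one rank-1-separated triple with
`|X||Y||Z| > B₃(p) = 1 + p³ + (p-2)(p+1)³ = p⁴ + 2p³ - 3p² - 5p - 1`. -/
def LevelOneBeatsCubes : Prop :=
  ∃ (p : ℕ) (_ : Fact p.Prime) (X Y Z : Finset (GLp 2 p)), RankSeparated p 2 1 X Y Z ∧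
    1 + p ^ 3 + (p - 2) * (p + 1) ^ 3 < X.card * Y.card * Z.card

/-! ## Card `borel-configuration-identity-test` -/

/-- Bi-invariance of the test space (used by (d) and by every target translation):
`f ∈ F_k ⇒ (g ↦ f(a g b)) ∈ F_k`. -/
theorem isRankTest_translate (p m k : ℕ) [Fact p.Prime] {f : GLp m p → ℂ}
    (hf : IsRankTest p m k f) (a b : GLp m p) :
    IsRankTest p m k (fun g => f (a * g * b)) := by
  obtain ⟨c, hc, hf⟩ := hf
  -- reindexing equivalence `M ↦ b M a` on matrices
  let e : Matrix (Fin m) (Fin m) (ZMod p) ≃ Matrix (Fin m) (Fin m) (ZMod p) :=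
    { toFun := fun M => (b : Matrix (Fin m) (Fin m) (ZMod p)) * M * (a : Matrix (Fin m) (Fin m) (ZMod p))
      invFun := fun M' => ((b⁻¹ : GLp m p) : Matrix (Fin m) (Fin m) (ZMod p)) * M' *
        ((a⁻¹ : GLp m p) : Matrix (Fin m) (Fin m) (ZMod p))
      left_inv := fun M => by
        simp only
        rw [show ((b⁻¹ : GLp m p) : Matrix (Fin m) (Fin m) (ZMod p)) * ((b : Matrix (Fin m) (Fin m) (ZMod p)) * M *
            (a : Matrix (Fin m) (Fin m) (ZMod p))) * ((a⁻¹ : GLp m p) : Matrix (Fin m) (Fin m) (ZMod p))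
            = (((b⁻¹ : GLp m p) : Matrix (Fin m) (Fin m) (ZMod p)) * (b : Matrix (Fin m) (Fin m) (ZMod p))) * M *
              ((a : Matrix (Fin m) (Fin m) (ZMod p)) * ((a⁻¹ : GLp m p) : Matrix (Fin m) (Fin m) (ZMod p))) by
            simp only [Matrix.mul_assoc]]
        rw [Units.inv_mul, Units.mul_inv, Matrix.one_mul, Matrix.mul_one]
      right_inv := fun M' => by
        simp only
        rw [show (b : Matrix (Fin m) (Fin m) (ZMod p)) * (((b⁻¹ : GLp m p) : Matrix (Fin m) (Fin m) (ZMod p)) * M' *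
            ((a⁻¹ : GLp m p) : Matrix (Fin m) (Fin m) (ZMod p))) * (a : Matrix (Fin m) (Fin m) (ZMod p))
            = ((b : Matrix (Fin m) (Fin m) (ZMod p)) * ((b⁻¹ : GLp m p) : Matrix (Fin m) (Fin m) (ZMod p))) * M' *
              (((a⁻¹ : GLp m p) : Matrix (Fin m) (Fin m) (ZMod p)) * (a : Matrix (Fin m) (Fin m) (ZMod p))) by
            simp only [Matrix.mul_assoc]]
        rw [Units.mul_inv, Units.inv_mul, Matrix.one_mul, Matrix.mul_one] }
  refine ⟨fun M' => c (e.symm M'), ?_, ?_⟩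
  · intro M' hM'
    apply hc
    -- rank is invariant under multiplication by invertible matrices
    have ha : IsUnit ((a⁻¹ : GLp m p) : Matrix (Fin m) (Fin m) (ZMod p)).det :=
      (Matrix.isUnit_iff_isUnit_det _).mp (Units.isUnit _)
    have hb : IsUnit ((b⁻¹ : GLp m p) : Matrix (Fin m) (Fin m) (ZMod p)).det :=
      (Matrix.isUnit_iff_isUnit_det _).mp (Units.isUnit _)
    show k < (((b⁻¹ : GLp m p) : Matrix (Fin m) (Fin m) (ZMod p)) * M' *
        ((a⁻¹ : GLp m p) : Matrix (Fin m) (Fin m) (ZMod p))).rank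
    rwa [Matrix.rank_mul_eq_left_of_isUnit_det _ _ ha, Matrix.rank_mul_eq_right_of_isUnit_det _ _ hb]
  · intro g
    show f (a * g * b) = _
    rw [hf (a * g * b)]
    refine Fintype.sum_equiv e _ _ (fun M => ?_)
    simp only [Equiv.symm_apply_apply]
    congr 2
    show Matrix.trace (M * ((a * g * b : GLp m p) : Matrix (Fin m) (Fin m) (ZMod p))) =
      Matrix.trace ((b : Matrix (Fin m) (Fin m) (ZMod p)) * M * (a : Matrix (Fin m) (Fin m) (ZMod p)) *
        (g : Matrix (Fin m) (Fin m) (ZMod p)))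
    simp only [Units.val_mul]
    rw [show M * ((a : Matrix (Fin m) (Fin m) (ZMod p)) * (g : Matrix (Fin m) (Fin m) (ZMod p)) *
        (b : Matrix (Fin m) (Fin m) (ZMod p))) = (M * a * g) * (b : Matrix (Fin m) (Fin m) (ZMod p)) by
          simp only [Matrix.mul_assoc],
      Matrix.trace_mul_comm, ← Matrix.mul_assoc, ← Matrix.mul_assoc]

open Literature.Barriers.MatrixMultiplication in
/-- FIRST LEMMA (d) — SUBGROUP DESIGNS COLLAPSE TO ONE CONDITION AT THE IDENTITY: for subgroups
`H₁, H₂, H₃ ≤ GL_m(𝔽_p)`, the crux's separation clause holds iff the subgroup TPP holds and ONE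
rank-`≤ k` test takes the value `[g = 1]` on the product set `H₁H₂H₃` (left `H₁` / right `H₃`
translation moves every target `x₀⁻¹z₀` to `1`; `F_k` is bi-invariant since `rk(z₀⁻¹ M x₀) = rk M`). -/
theorem subgroup_rankSeparated_iff (p m k : ℕ) [Fact p.Prime] (H₁ H₂ H₃ : Subgroup (GLp m p))
    [DecidablePred (· ∈ H₁)] [DecidablePred (· ∈ H₂)] [DecidablePred (· ∈ H₃)] :
    RankSeparated p m k (Finset.univ.filter (· ∈ H₁)) (Finset.univ.filter (· ∈ H₂))
        (Finset.univ.filter (· ∈ H₃)) ↔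
      SubgroupTPP H₁ H₂ H₃ ∧ ∃ f : GLp m p → ℂ, IsRankTest p m k f ∧ f 1 = 1 ∧
        ∀ a ∈ H₁, ∀ b ∈ H₂, ∀ c ∈ H₃, a * b * c ≠ 1 → f (a * b * c) = 0 := by
  have memX : ∀ {H : Subgroup (GLp m p)} [DecidablePred (· ∈ H)] {x : GLp m p},
      x ∈ Finset.univ.filter (· ∈ H) ↔ x ∈ H := by
    intro H _ x; simp
  constructor
  · -- (⇒) separation at the target (1,1) gives TPP and the identity test
    intro hsep
    obtain ⟨c₁, hc₁, h₁⟩ := hsep 1 (memX.mpr H₁.one_mem) 1 (memX.mpr H₃.one_mem)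
    -- value at the identity
    have hone : (∑ M : Matrix (Fin m) (Fin m) (ZMod p), c₁ M * ZMod.stdAddChar (Matrix.trace
        (M * ((1 : GLp m p) : Matrix (Fin m) (Fin m) (ZMod p))))) = 1 := by
      have := h₁ 1 (memX.mpr H₁.one_mem) 1 (memX.mpr H₂.one_mem) 1 (memX.mpr H₂.one_mem)
        1 (memX.mpr H₃.one_mem)
      simpa using this
    -- the key evaluation: x = a⁻¹, y = b, y' = 1, z = c
    have key : ∀ a ∈ H₁, ∀ b ∈ H₂, ∀ c ∈ H₃,
        (∑ M : Matrix (Fin m) (Fin m) (ZMod p), c₁ M * ZMod.stdAddChar (Matrix.trace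
          (M * ((a * b * c : GLp m p) : Matrix (Fin m) (Fin m) (ZMod p))))) =
          if a⁻¹ = 1 ∧ b = 1 ∧ c = 1 then 1 else 0 := by
      intro a ha b hb c hc
      have := h₁ a⁻¹ (memX.mpr (H₁.inv_mem ha)) b (memX.mpr hb) 1 (memX.mpr H₂.one_mem) c (memX.mpr hc)
      simpa using this
    have tpp : SubgroupTPP H₁ H₂ H₃ := by
      intro a ha b hb c hc habc
      have h := key a ha b hb c hc
      rw [habc] at h
      rw [hone] at h
      by_cases hcond : a⁻¹ = 1 ∧ b = 1 ∧ c = 1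
      · exact ⟨inv_eq_one.mp hcond.1, hcond.2.1, hcond.2.2⟩
      · rw [if_neg hcond] at h; exact absurd h one_ne_zero
    refine ⟨tpp, fun g => ∑ M : Matrix (Fin m) (Fin m) (ZMod p), c₁ M * ZMod.stdAddChar
      (Matrix.trace (M * (g : Matrix (Fin m) (Fin m) (ZMod p)))), ⟨c₁, hc₁, fun g => rfl⟩, hone, ?_⟩
    intro a ha b hb c hc habc
    show (∑ M : Matrix (Fin m) (Fin m) (ZMod p), c₁ M * ZMod.stdAddChar (Matrix.trace
      (M * ((a * b * c : GLp m p) : Matrix (Fin m) (Fin m) (ZMod p))))) = 0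
    rw [key a ha b hb c hc, if_neg]
    rintro ⟨ha1, hb1, hc1⟩
    exact habc (by rw [inv_eq_one.mp ha1, hb1, hc1, one_mul, one_mul])
  · -- (⇐) translate the identity test to every target
    rintro ⟨tpp, f, hf, hf1, hf0⟩ x₀ hx₀ z₀ hz₀
    obtain ⟨c₁, hc₁, hfc⟩ := isRankTest_translate p m k hf x₀ z₀⁻¹
    refine ⟨c₁, hc₁, ?_⟩
    intro x hx y hy y' hy' z hz
    rw [← hfc (x⁻¹ * y * y'⁻¹ * z)]
    have hregroup : x₀ * (x⁻¹ * y * y'⁻¹ * z) * z₀⁻¹ = (x₀ * x⁻¹) * (y * y'⁻¹) * (z * z₀⁻¹) := by group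
    simp only [hregroup]
    have ha : x₀ * x⁻¹ ∈ H₁ := H₁.mul_mem (memX.mp hx₀) (H₁.inv_mem (memX.mp hx))
    have hb : y * y'⁻¹ ∈ H₂ := H₂.mul_mem (memX.mp hy) (H₂.inv_mem (memX.mp hy'))
    have hc : z * z₀⁻¹ ∈ H₃ := H₃.mul_mem (memX.mp hz) (H₃.inv_mem (memX.mp hz₀))
    by_cases h1 : (x₀ * x⁻¹) * (y * y'⁻¹) * (z * z₀⁻¹) = 1
    · obtain ⟨e1, e2, e3⟩ := tpp _ ha _ hb _ hc h1
      have ex : x = x₀ := (mul_inv_eq_one.mp e1).symm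
      have ey : y = y' := mul_inv_eq_one.mp e2
      have ez : z = z₀ := mul_inv_eq_one.mp e3
      rw [h1, hf1, if_pos ⟨ex, ey, ez⟩]
    · rw [hf0 _ ha _ hb _ hc h1, if_neg]
      rintro ⟨ex, ey, ez⟩
      apply h1
      rw [ex, ey, ez, mul_inv_cancel, mul_inv_cancel, mul_inv_cancel, one_mul, one_mul]

open Literature.Barriers.MatrixMultiplication in
/-- FIRST LEMMA (e) — BOREL CONFIGURATIONS HAVE THE TPP (LDU uniqueness): `H₁` lower unitriangular,
`H₂, H₃` upper triangular with `H₂ ⊓ H₃ = ⊥`.  (`a = (bc)⁻¹` is upper triangular and lower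
unitriangular, hence `1`; then `b = c⁻¹ ∈ H₂ ⊓ H₃`.) -/
theorem borelConfig_subgroupTPP {m p : ℕ} [Fact p.Prime] (H₁ H₂ H₃ : Subgroup (GLp m p))
    (h₁ : ∀ a ∈ H₁, (∀ i j : Fin m, i < j → (a : Matrix (Fin m) (Fin m) (ZMod p)) i j = 0) ∧
      ∀ i : Fin m, (a : Matrix (Fin m) (Fin m) (ZMod p)) i i = 1)
    (h₂ : ∀ b ∈ H₂, ∀ i j : Fin m, j < i → (b : Matrix (Fin m) (Fin m) (ZMod p)) i j = 0)
    (h₃ : ∀ c ∈ H₃, ∀ i j : Fin m, j < i → (c : Matrix (Fin m) (Fin m) (ZMod p)) i j = 0)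
    (hdisj : H₂ ⊓ H₃ = ⊥) :
    SubgroupTPP H₁ H₂ H₃ := by
  intro a ha b hb c hc habc
  -- `a = (b c)⁻¹` is upper triangular
  have habc' : a = (b * c)⁻¹ := by
    rw [eq_inv_iff_mul_eq_one, ← mul_assoc]; exact habc
  have hbc : ((b * c : GLp m p) : Matrix (Fin m) (Fin m) (ZMod p)).BlockTriangular id := by
    rw [Units.val_mul]
    exact Matrix.BlockTriangular.mul (fun i j hij => h₂ b hb i j hij) (fun i j hij => h₃ c hc i j hij)
  have haup : (a : Matrix (Fin m) (Fin m) (ZMod p)).BlockTriangular id := by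
    rw [habc', Matrix.coe_units_inv]
    haveI : Invertible ((b * c : GLp m p) : Matrix (Fin m) (Fin m) (ZMod p)) := (b * c).invertible
    exact Matrix.blockTriangular_inv_of_blockTriangular hbc
  -- lower unitriangular and upper triangular ⇒ identity
  have ha1 : a = 1 := by
    apply Units.ext
    ext i j
    rcases lt_trichotomy i j with hij | rfl | hji
    · rw [(h₁ a ha).1 i j hij, Units.val_one, Matrix.one_apply_ne (ne_of_lt hij)]
    · rw [(h₁ a ha).2 i, Units.val_one, Matrix.one_apply_eq]
    · rw [haup hji, Units.val_one, Matrix.one_apply_ne (ne_of_gt hji)]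
  -- then `b = c⁻¹ ∈ H₂ ⊓ H₃ = ⊥`
  have hbc1 : b * c = 1 := by simpa [ha1] using habc
  have hb3 : b ∈ H₃ := by
    have : b = c⁻¹ := eq_inv_of_mul_eq_one_left hbc1
    rw [this]; exact H₃.inv_mem hc
  have hb1 : b = 1 := by
    have hmem : b ∈ H₂ ⊓ H₃ := Subgroup.mem_inf.mpr ⟨hb, hb3⟩
    rw [hdisj] at hmem
    exact Subgroup.mem_bot.mp hmem
  have hc1 : c = 1 := by simpa [hb1] using hbc1
  exact ⟨ha1, hb1, hc1⟩

open Literature.Barriers.MatrixMultiplication in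
/-- The Borel-template design conjecture at `(m,k) = (22,4)` (Transfer `C⁺` of card 2): the level-`k`
template `H₁ = S₁ ⋉ U⁻_{cols 1..k}`, `H₂ = S₂ ⋉ U⁺_{rows k+1..2k}`, `H₃ = S₃ ⋉ U⁺_{rows 1..k}`
(coordinate tori: `S₁ ⊔ S₃` a splitting of the first `k` coordinates with `rk S₁ = rk S₃ = k/2`,
`S₂` on `≤ k-1` of the coordinates `k+1..2k` and on `2k+1..m`) has the subgroup TPP, passes the
frame-faithfulness filter (N), meets the three level-`k` walls and the graded Neumann inequality, with
volume `Θ(W_k^{3/2}/p)`; the first instance beating the cube budget is `k = 4`, `m = 22`, volume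
`(p-1)^{21} p^{218} ≈ p^{239}` against `B₃(22,4) ≈ p^{238}`.  `C⁺`: such subgroup triples of
`GL_22(𝔽_p)` with ONE rank-`≤ 4` test equal to `[g = 1]` on `H₁H₂H₃`, for unboundedly many `p`.
By `subgroup_rankSeparated_iff` they are `RankSeparated p 22 4`; with the level-4 budget
`B_s(22,4) ≤ C^s p^{78 s + 4}` the companion card's rpow bookkeeping gives `ω ≤ s` for every
`s > 12/5` (`239 s / 3 > 78 s + 4 ⇔ s > 2.4`) — NOT the crux (which needs every `ε`), but the
`k`-indexed family gives `ω ≤ 2 + 4/(3k-2) → 2`, i.e. the crux, if separable at every even `k`.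
Stated as the target of the line; not used below. -/
def BorelTemplateDesigns224 : Prop :=
  ∃ c : ℝ, 0 < c ∧ ∀ p₀ : ℕ, ∃ (p : ℕ) (_ : Fact p.Prime), p₀ ≤ p ∧
    ∃ H₁ H₂ H₃ : Subgroup (GLp 22 p), SubgroupTPP H₁ H₂ H₃ ∧
      c * (p : ℝ) ^ (239 : ℝ) ≤ (Nat.card H₁ * Nat.card H₂ * Nat.card H₃ : ℕ) ∧
      ∃ f : GLp 22 p → ℂ, IsRankTest p 22 4 f ∧ f 1 = 1 ∧
        ∀ a ∈ H₁, ∀ b ∈ H₂, ∀ c ∈ H₃, a * b * c ≠ 1 → f (a * b * c) = 0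

open Literature.Barriers.MatrixMultiplication in
/-- The `k`-indexed family behind card 2 (the crux-level transfer): for every even `k ≥ 4` and
unboundedly many primes, level-`k` template triples in `GL_m(𝔽_p)`, `m = k² + 3k/2`, rank-`k`
separated at the identity with volume `≥ c_k · p^{3(mk - k²/2) - 1}` (`= W_k^{3/2}/p` scale). -/
def BorelTemplateFamily : Prop :=
  ∀ k : ℕ, 4 ≤ k → Even k → ∃ c : ℝ, 0 < c ∧ ∀ p₀ : ℕ, ∃ (p : ℕ) (_ : Fact p.Prime), p₀ ≤ p ∧
    ∃ H₁ H₂ H₃ : Subgroup (GLp (k ^ 2 + 3 * k / 2) p), SubgroupTPP H₁ H₂ H₃ ∧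
      c * (p : ℝ) ^ ((3 * ((k ^ 2 + 3 * k / 2) * k : ℕ) : ℝ) - 3 * (k : ℝ) ^ 2 / 2 - 1) ≤
        (Nat.card H₁ * Nat.card H₂ * Nat.card H₃ : ℕ) ∧
      ∃ f : GLp (k ^ 2 + 3 * k / 2) p → ℂ, IsRankTest p (k ^ 2 + 3 * k / 2) k f ∧ f 1 = 1 ∧
        ∀ a ∈ H₁, ∀ b ∈ H₂, ∀ c ∈ H₃, a * b * c ≠ 1 → f (a * b * c) = 0

end Summit.MatrixMultiplication.MatrixMultiplication.Cruxes.LieRankDesigns.Ideator2
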